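import Literature.NumberTheory.Automorphic.GLnAdelicStructure
import Mathlib.NumberTheory.NumberField.Units.DirichletTheorem
import Mathlib.NumberTheory.NumberField.InfinitePlace.TotallyRealComplex
import Mathlib.RingTheory.Norm.Basic
import HarnessLib

/-!
# Neat congruence levels exist over imaginary quadratic fields

Topic `NumberTheory/Automorphic`; namespace `Literature.NumberTheory.Automorphic`, grouping
sub-namespace `BigHeckeGLn` (`idealRadius`).  Theorems only.

For an imaginary quadratic field `F` (totally complex of degree `2`) the unit group `𝓞_F^×` is
finite (Dirichlet: rank `r₁ + r₂ - 1 = 0`), so for a large integer `N` no unit `u ≠ 1` satisfies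
`u ≡ 1 (mod N)` (norms: `|Nm(u - 1)| < N ≤ N² |Nm x|`).  Consequently
(`exists_neat_level`) every non-zero ideal `𝔫₀` contains a non-zero ideal `𝔫` which is NEAT in the
sense used for the Borel stabilisers (`BorelStabilizerLattice.mem_orbitStabilizer_borel_iff`):

  the only `a ∈ F` with `|a|_v ≤ 1`, `|a⁻¹|_v ≤ 1` and `|a - 1|_v ≤ |𝔫|_v` for all `v` is `a = 1`.

[cite: Harder1987, §2]

## References

* G. Harder, *Eisenstein cohomology of arithmetic groups. The case GL₂*, Invent. Math. 89 (1987), §2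
  [Harder1987].
-/

noncomputable section

open scoped NumberField
open IsDedekindDomain NumberField

namespace Literature.NumberTheory.Automorphic

namespace BigHeckeGLn

variable {F : Type} [Field F] [NumberField F]

/-! ### Finiteness of the unit group -/

/-- An imaginary quadratic field has unit rank `0`. [folklore] -/
theorem units_rank_eq_zero [IsTotallyComplex F] (hF : Module.finrank ℚ F = 2) :
    Units.rank F = 0 := by
  have h1 := IsTotallyComplex.finrank (K := F)
  have h2 := InfinitePlace.card_eq_nrRealPlaces_add_nrComplexPlaces (K := F)
  rw [IsTotallyComplex.nrRealPlaces_eq_zero, zero_add] at h2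
  rw [Units.rank, h2]
  omega

/-- **The unit group of an imaginary quadratic field is finite** (it is its torsion).
[folklore] -/
theorem finite_units [IsTotallyComplex F] (hF : Module.finrank ℚ F = 2) :
    Finite (𝓞 F)ˣ := by
  have hr := units_rank_eq_zero hF
  haveI : IsEmpty (Fin (Units.rank F)) := by rw [hr]; infer_instance
  have hmem : ∀ x : (𝓞 F)ˣ, x ∈ Units.torsion F := by
    intro x
    obtain ⟨⟨ζ, e⟩, hx, -⟩ := Units.exist_unique_eq_mul_prod (K := F) x
    rw [hx, Finset.univ_eq_empty, Finset.prod_empty, mul_one]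
    exact ζ.2
  exact Finite.of_injective (fun x : (𝓞 F)ˣ => (⟨x, hmem x⟩ : Units.torsion F))
    fun x y h => by simpa using congrArg Subtype.val h

/-! ### A neat integer -/

/-- **A neat integer**: some `N ≥ 2` such that no unit `u ≠ 1` is `≡ 1 (mod N)`. [folklore] -/
theorem exists_neat_nat [IsTotallyComplex F] (hF : Module.finrank ℚ F = 2) :
    ∃ N : ℕ, 2 ≤ N ∧ ∀ (u : (𝓞 F)ˣ) (x : 𝓞 F), (u : 𝓞 F) - 1 = (N : 𝓞 F) * x → u = 1 := by
  classical
  haveI := finite_units hF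
  haveI := Fintype.ofFinite (𝓞 F)ˣ
  -- `N` exceeds all `|Nm(u - 1)|`
  set N : ℕ := 2 + ∑ u : (𝓞 F)ˣ, (Algebra.norm ℤ ((u : 𝓞 F) - 1)).natAbs with hN
  refine ⟨N, by omega, fun u x hux => ?_⟩
  by_contra hu
  have hne : (u : 𝓞 F) - 1 ≠ 0 := by
    intro h
    exact hu (Units.ext (sub_eq_zero.1 h))
  have hx0 : x ≠ 0 := by
    rintro rfl
    rw [mul_zero] at hux
    exact hne hux
  have hrank : Module.finrank ℤ (𝓞 F) = 2 := by rw [RingOfIntegers.rank, hF]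
  have hnorm : Algebra.norm ℤ ((u : 𝓞 F) - 1) = (N : ℤ) ^ 2 * Algebra.norm ℤ x := by
    rw [hux, map_mul, ← map_natCast (algebraMap ℤ (𝓞 F)) N, Algebra.norm_algebraMap, hrank]
  have hxn : Algebra.norm ℤ x ≠ 0 := Algebra.norm_ne_zero_iff.2 hx0
  have hle : (Algebra.norm ℤ ((u : 𝓞 F) - 1)).natAbs < N := by
    have := Finset.single_le_sum (f := fun u : (𝓞 F)ˣ => (Algebra.norm ℤ ((u : 𝓞 F) - 1)).natAbs)
      (fun _ _ => Nat.zero_le _) (Finset.mem_univ u)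
    omega
  have hge : N ≤ (Algebra.norm ℤ ((u : 𝓞 F) - 1)).natAbs := by
    rw [hnorm, Int.natAbs_mul, Int.natAbs_pow, Int.natAbs_natCast]
    have h1 : 1 ≤ (Algebra.norm ℤ x).natAbs := Int.natAbs_pos.2 hxn
    calc N ≤ N ^ 2 := Nat.le_self_pow two_ne_zero N
      _ ≤ N ^ 2 * (Algebra.norm ℤ x).natAbs := Nat.le_mul_of_pos_right _ h1
  omega

/-! ### Neat levels -/

/-- `|(N)|_v = |N|_v` for the principal ideal of a non-zero natural number. [folklore] -/
theorem idealRadius_span_natCast {N : ℕ} (hN : N ≠ 0) (v : HeightOneSpectrum (𝓞 F)) :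
    idealRadius F v (Ideal.span {(N : 𝓞 F)}) = v.valuation F (N : F) := by
  have hN' : (N : 𝓞 F) ≠ 0 := Nat.cast_ne_zero.2 hN
  have h0 : Ideal.span {(N : 𝓞 F)} ≠ 0 := by
    rwa [Ne, Ideal.zero_eq_bot, Ideal.span_singleton_eq_bot]
  rw [idealRadius, FractionalIdeal.count_coe F v h0,
    show ((N : F)) = algebraMap (𝓞 F) F (N : 𝓞 F) by simp, v.valuation_of_algebraMap,
    v.intValuation_if_neg hN']

/-- `|𝔫₀ (N)|_v ≤ |N|_v`. [folklore] -/
theorem idealRadius_mul_span_natCast_le {𝔫₀ : Ideal (𝓞 F)} (h𝔫₀ : 𝔫₀ ≠ 0) {N : ℕ} (hN : N ≠ 0)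
    (v : HeightOneSpectrum (𝓞 F)) :
    idealRadius F v (𝔫₀ * Ideal.span {(N : 𝓞 F)}) ≤ v.valuation F (N : F) := by
  rw [← idealRadius_span_natCast hN v]
  have hN' : (N : 𝓞 F) ≠ 0 := Nat.cast_ne_zero.2 hN
  have h0 : Ideal.span {(N : 𝓞 F)} ≠ 0 := by
    rwa [Ne, Ideal.zero_eq_bot, Ideal.span_singleton_eq_bot]
  have hm0 : 𝔫₀ * Ideal.span {(N : 𝓞 F)} ≠ 0 := mul_ne_zero h𝔫₀ h0
  unfold idealRadius
  rw [WithZero.exp_le_exp, neg_le_neg_iff]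
  exact FractionalIdeal.count_mono F v (FractionalIdeal.coeIdeal_ne_zero.mpr hm0)
    ((FractionalIdeal.coeIdeal_le_coeIdeal F).mpr Ideal.mul_le_left)

/-- `|a - 1|_v ≤ |N|_v` for all `v` means `a - 1 ∈ N 𝓞_F`. [folklore] -/
theorem exists_sub_one_eq_mul {N : ℕ} (hN : N ≠ 0) {a : F}
    (h : ∀ v : HeightOneSpectrum (𝓞 F), v.valuation F (a - 1) ≤ v.valuation F (N : F)) :
    ∃ y : 𝓞 F, a - 1 = (N : F) * y := by
  have hN' : (N : F) ≠ 0 := Nat.cast_ne_zero.2 hN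
  have hint : ∀ v : HeightOneSpectrum (𝓞 F), v.valuation F ((a - 1) / N) ≤ 1 := by
    intro v
    have hvN : v.valuation F (N : F) ≠ 0 := (Valuation.ne_zero_iff _).2 hN'
    rw [map_div₀, div_le_iff₀ (zero_lt_iff.2 hvN), one_mul]
    exact h v
  obtain ⟨y, hy⟩ := HeightOneSpectrum.mem_integers_of_valuation_le_one F _ hint
  refine ⟨y, ?_⟩
  rw [eq_div_iff hN'] at hy
  rw [← hy, mul_comm]

/-- **Neat levels exist**: inside every non-zero ideal `𝔫₀` of an imaginary quadratic field there
is a non-zero ideal `𝔫` such that the only `a ∈ F` with `a, a⁻¹` everywhere integral and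
`|a - 1|_v ≤ |𝔫|_v` for all `v` is `a = 1`. [cite: Harder1987, §2] -/
theorem exists_neat_level [IsTotallyComplex F] (hF : Module.finrank ℚ F = 2)
    {𝔫₀ : Ideal (𝓞 F)} (h𝔫₀ : 𝔫₀ ≠ 0) :
    ∃ 𝔫 : Ideal (𝓞 F), 𝔫 ≠ 0 ∧ 𝔫 ≤ 𝔫₀ ∧
      ∀ a : F, (∀ v : HeightOneSpectrum (𝓞 F), v.valuation F a ≤ 1) →
        (∀ v : HeightOneSpectrum (𝓞 F), v.valuation F a⁻¹ ≤ 1) →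
        (∀ v : HeightOneSpectrum (𝓞 F), v.valuation F (a - 1) ≤ idealRadius F v 𝔫) → a = 1 := by
  obtain ⟨N, hN2, hN⟩ := exists_neat_nat hF
  have hN0 : N ≠ 0 := by omega
  have h0 : Ideal.span {(N : 𝓞 F)} ≠ 0 := by
    rw [Ne, Ideal.zero_eq_bot, Ideal.span_singleton_eq_bot]; exact Nat.cast_ne_zero.2 hN0
  refine ⟨𝔫₀ * Ideal.span {(N : 𝓞 F)}, mul_ne_zero h𝔫₀ h0, Ideal.mul_le_right, fun a ha hainv ha1 => ?_⟩
  -- `a - 1 = N y`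
  obtain ⟨y, hy⟩ := exists_sub_one_eq_mul hN0
    (fun v => (ha1 v).trans (idealRadius_mul_span_natCast_le h𝔫₀ hN0 v))
  -- `a` and `a⁻¹` are integers
  obtain ⟨b, hb⟩ := HeightOneSpectrum.mem_integers_of_valuation_le_one F a ha
  obtain ⟨b', hb'⟩ := HeightOneSpectrum.mem_integers_of_valuation_le_one F a⁻¹ hainv
  have hrank : Module.finrank ℤ (𝓞 F) = 2 := by rw [RingOfIntegers.rank, hF]
  by_cases ha0 : a = 0
  · -- `-1 = N y` is impossible for `N ≥ 2` (norms)
    exfalso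
    rw [ha0, zero_sub] at hy
    have hy' : (-1 : 𝓞 F) = (N : 𝓞 F) * y := by
      apply IsFractionRing.injective (𝓞 F) F
      simpa using hy
    have hy'' : (1 : 𝓞 F) = (N : 𝓞 F) * (-y) := by rw [mul_neg, ← hy', neg_neg]
    have hn := congrArg (Algebra.norm ℤ) hy''
    rw [map_one, map_mul, ← map_natCast (algebraMap ℤ (𝓞 F)) N, Algebra.norm_algebraMap,
      hrank] at hn
    have habs := congrArg Int.natAbs hn
    rw [Int.natAbs_one, Int.natAbs_mul, Int.natAbs_pow, Int.natAbs_natCast] at habs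
    have : N ^ 2 ∣ 1 := ⟨_, habs⟩
    have hN1 : N ^ 2 ≤ 1 := Nat.le_of_dvd one_pos this
    nlinarith
  · -- `a` is a unit of `𝓞 F` congruent to `1 mod N`
    have hbb' : b * b' = 1 := by
      apply IsFractionRing.injective (𝓞 F) F
      rw [map_mul, hb, hb', map_one, mul_inv_cancel₀ ha0]
    let u : (𝓞 F)ˣ := ⟨b, b', hbb', by rw [mul_comm]; exact hbb'⟩
    have hu : (u : 𝓞 F) - 1 = (N : 𝓞 F) * y := by
      apply IsFractionRing.injective (𝓞 F) F
      rw [map_sub, map_one, map_mul, map_natCast]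
      change algebraMap (𝓞 F) F b - 1 = _
      rw [hb, hy]
    have := hN u y hu
    have hb1 : b = 1 := by simpa [u] using congrArg Units.val this
    rw [← hb, hb1, map_one]

end BigHeckeGLn

end Literature.NumberTheory.Automorphic
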